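import Summits.QuantumFields.YangMills.Theorems.BalabanUVNodesN07SeamWitnessCurve
import Literature.MathematicalPhysics.QuantumFieldTheory.Balaban1983to89.Node00.CriticalOnFibre
import HarnessLib

/-!
# N07 [B11] ∕ K0⁷ chart road — THE SEAM WITNESS, part C₁: A (b)-CRITICAL CONFIGURATION WITHOUT A VARIATIONAL PROBLEM — the exterior diagonal twist next to
# the corner of the block `B(0)` is critical on the record's fibre of `Γ₀ = Ω₁ᶜ` by Fermat alone; and the plaquette dichotomy along the two-connector twist

Cell `pub-ymgap`, seat `pub-ymgap-dag-n07-w3` g15 (WIDTH SEAT 3 on N07).  `--kind proof --supports stmt-QuantumFields-20541 --as helper` (K0⁷; count-neutral;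
NEGATIVE-SIDE helper).  [15] = [Balaban1985Variational]; [III] = [Balaban1988Convergent]; [I] = [Balaban1987RG1]; [II] = [Balaban1984PropagatorsII].

THE POINT (director-ym №335 (B), dag-n07-e `LOCATE-HSEAM` (γ): HSEAM — «(b)-critical ⇒ stationary along every [II] (2.3)-admissible curve» — is the displayed premise of the
K0⁷ chart road; its refutation was held to need «an SU(2) minimiser computation, L-sized»).  NO MINIMISER IS NEEDED: take `Ω₁ = B(0)` (dag-n21-c's one-cube index) and the
configuration `U` equal to `g₀` on ONE EXTERIOR fine bond `e = ⟨x, μ₀⟩`, `x = π(−e_{μ₀} − e_{ν₁})` — the bond of the corner plaquette `p₀ = ⟨x; μ₀, ν₁⟩` diagonal to the cube's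
corner `π(0)` — and `1` elsewhere.  Every plaquette carrying `e` has its source and its two near corners OUTSIDE `Ω₁` (a coordinate `−1` or `−2`), so along ANY curve in the
record's fibre `{M_𝐁(·) = M_𝐁(U)}` of `𝐁 = genSet Ω 1` those plaquettes are PINNED (`Γ₀ = Ω₁ᶜ`, `M⁰ = id`: dag-n21-c `plaqHol_eq_of_agreeOn`), while every other plaquette is FLAT
at `U`; hence `A(γ′ t) ≥ A(U)` near `t = 0` and Fermat gives `IsCritOnFibre F N K (genSet Ω 1) (M_𝐁 U) U` (§3) — for EVERY `g₀`, no smallness, no class, no solvability.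
§4 records, for part C₂'s derivative, the plaquette dichotomy along the two-connector twist `V = (g on ⟨x + e_{ν₁}, μ₀⟩)·(g⁻¹ on ⟨x + 2e_{ν₁}, μ₀⟩)·U`: at `p₀` the plaquette
variable is `g₀·g⁻¹`; at every other plaquette it is `U`'s, or `U`'s is `1`.

HONEST FRAMING: kernel bookkeeping on explicit lattice configurations (Fermat's lemma + torus coordinates); nothing of Bałaban [15]∕[III]∕[I]∕[II] asserted or refuted; used ONLY
by part C₂ to certify that HSEAM AS DISPLAYED is uninhabited; it does not bear on (E1)∕(E3); K0⁷ stub 1 NOT closed; N05 ∕ N07 NOT discharged; counts unmoved (typed 28∕28 ·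
discharged 8∕28); one finite 𝕋⁴ programme at fixed ε — R4 closes the conditional finite-𝕋⁴ rung `BalabanLadder.UV` only; the YM mass gap (Clay) is NOT proved by any of this; nothing
continuum ∕ ℝ⁴ ∕ OS.  No `def`, no `instance`, no `notation`, no `sorry`.

References: [15] (5)–(6) p. 278, Prop. 8 p. 304; [III] (2.2) p. 255, (2.10)–(2.12) p. 256; [I] (0.1)–(0.2) pp. 251–252; [II] (2.3) p. 224.
-/

set_option autoImplicit false

noncomputable section

open scoped Matrix.Norms.L2Operator BigOperators Topology

namespace Summit.QuantumFields.YangMills.BalabanUVNodes.N07SeamWitness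

open Filter
open Literature.MathematicalPhysics.QuantumFieldTheory.Balaban1983to89
open Literature.MathematicalPhysics.QuantumFieldTheory.Balaban1983to89.Node00
open Literature.MathematicalPhysics.QuantumFieldTheory.Balaban1983to89.T4Continuum
open B15Eq112TorusCover B14DomainGeom B15DeterminingSets B15LatticeCubeTorus
open Summit.QuantumFields.YangMills.Theorems.K0BgProvisoOverRange (shift_cover)
open Summit.QuantumFields.YangMills.Theorems.K0AveragedSingleBondFloor (intCast_ne_zero_of_natAbs_lt)
open Summit.QuantumFields.YangMills.Theorems.K0VariationalThm1ScaledCorner (plaqHol_eq_of_agreeOn)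

variable {P : Params}

/-! ## §1  Torus helpers -/
section Torus

/-- `π(w) − e_ν = π(w − e_ν)`. [cite: Balaban1987RG1, (0.1) p.251 (bookkeeping)] -/
theorem unshift_cover (w : Pt P.d) (ν : Fin P.d) : (cover P w).unshift ν = cover P (Function.update w ν (w ν - 1)) := by
  funext κ
  rw [Site.unshift_apply]
  simp only [cover_apply, Function.update_apply]
  by_cases h : κ = ν
  · subst h; simp
  · simp [h]

/-- **A lattice point with a SMALL NEGATIVE coordinate is outside the cube `π([0, s−1]ᵈ)`**: a deck translate `z + 2L^{m+K}·v` of a box point `z` (`0 ≤ z_i ≤ s − 1`) never has a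
coordinate in `[s − 2L^{m+K}, −1]`.  (dag-n21-c's `cover_notMem_cubeEnl_zero` is the value `−1`.) [cite: Balaban1987RG1, (0.1) p.251 (bookkeeping)] -/
theorem cover_notMem_cubeEnl_zero_of_neg {s : ℕ} (w : Pt P.d) {i : Fin P.d} (hneg : w i < 0) (hlow : (s : ℤ) - P.sitesPerDir 0 ≤ w i) :
    cover P w ∉ cubeEnl P s 0 0 := by
  rintro ⟨z, hz, hzw⟩
  obtain ⟨v, hv⟩ := (cover_eq_cover_iff z w).1 hzw
  have hzi := hz i
  simp only [Pi.zero_apply, mul_zero, Nat.zero_mul, Nat.cast_zero, sub_zero, add_zero, zero_add] at hzi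
  have hvi : w i = z i + (P.sitesPerDir 0 : ℤ) * v i := by
    have := congrFun hv i
    simpa [pmul, per] using this
  have hS0 : (0 : ℤ) ≤ (P.sitesPerDir 0 : ℤ) := by positivity
  rcases lt_trichotomy (v i) 0 with hv0 | hv0 | hv0
  · have hle : v i ≤ -1 := by omega
    have : (P.sitesPerDir 0 : ℤ) * v i ≤ (P.sitesPerDir 0 : ℤ) * (-1) := mul_le_mul_of_nonneg_left hle hS0
    omega
  · rw [hv0, mul_zero, add_zero] at hvi
    omega
  · have hle : 1 ≤ v i := by omega
    have : (P.sitesPerDir 0 : ℤ) * 1 ≤ (P.sitesPerDir 0 : ℤ) * v i := mul_le_mul_of_nonneg_left hle hS0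
    omega

/-- **The block `B(0)` is the cube `π([0, L−1]ᵈ)`**: a fine site whose block is `0` has all residues `< L`, so it is the image of a box point (standing range).
[cite: Balaban1987RG1, (0.1)–(0.3) pp.251–252 (bookkeeping)] -/
theorem mem_cubeEnl_zero_of_blockOf_eq_zero (hj : 0 + 1 ≤ P.m + P.K) (z : Site P 0) (hz : blockOf z = 0) : z ∈ cubeEnl P P.L 0 0 := by
  refine ⟨lift P z, fun i => ?_, cover_lift z⟩
  have h1 : ((blockOf z) i).val = (z i).val / P.L := Site.val_blockOf hj z i
  rw [hz, Site.zero_apply, ZMod.val_zero] at h1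
  have h2 : (z i).val < P.L := by
    by_contra h
    have : 1 ≤ (z i).val / P.L := (Nat.one_le_div_iff P.L_pos).2 (not_lt.1 h)
    omega
  simp only [lift, Pi.zero_apply, mul_zero, Nat.zero_mul, Nat.cast_zero, sub_zero, add_zero, zero_add]
  constructor
  · positivity
  · have : ((z i).val : ℤ) ≤ (P.L : ℤ) - 1 := by omega
    simpa using this

/-- Two fine sites whose `ν`-coordinates differ by a nonzero integer of modulus below the period are distinct. [cite: Balaban1987RG1, (0.1) p.251 (bookkeeping)] -/
theorem site_ne_of_coord {j : ℕ} {z z' : Site P j} (ν : Fin P.d) (c : ℤ) (hc : z' ν = z ν + (c : ZMod (P.sitesPerDir j))) (h0 : c ≠ 0)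
    (hlt : c.natAbs < P.sitesPerDir j) : z ≠ z' := by
  intro h
  rw [h] at hc
  have : ((c : ℤ) : ZMod (P.sitesPerDir j)) = 0 := by
    have := sub_eq_zero.mpr hc.symm; simpa using this
  exact intCast_ne_zero_of_natAbs_lt h0 hlt this

end Torus

/-! ## §2  The exterior diagonal twist `U = (g₀ on ⟨π(−e_{μ₀} − e_{ν₁}), μ₀⟩)`: which plaquettes see it, and that they are pinned by `Γ₀ = B(0)ᶜ` -/
section ExteriorTwist

variable {G : Type*} [GaugeGroup G]

/-- **A plaquette whose variable in the single-bond configuration `(g₀ on ⟨x, μ₀⟩, 1 elsewhere)` is not `1` carries the bond `⟨x, μ₀⟩` in one of its four slots.**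
[cite: Balaban1985Averaging, (9) p.19 (bookkeeping)] -/
theorem slots_of_plaqHol_single_ne_one (x : Site P 0) (μ0 : Fin P.d) (g₀ : G) (p : Plaq P 0)
    (hp : GaugeField.plaqHol (fun b : PBond P 0 => if b.src = x ∧ b.dir = μ0 then g₀ else 1) p ≠ 1) :
    (p.src = x ∧ p.μ = μ0) ∨ (p.src.shift p.μ = x ∧ p.ν = μ0) ∨ (p.src.shift p.ν = x ∧ p.μ = μ0) ∨ (p.src = x ∧ p.ν = μ0) := by
  by_contra hcon
  push Not at hcon
  obtain ⟨h1, h2, h3, h4⟩ := hcon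
  apply hp
  simp only [GaugeField.plaqHol]
  rw [if_neg (fun h => h1 h.1 h.2), if_neg (fun h => h2 h.1 h.2), if_neg (fun h => h3 h.1 h.2), if_neg (fun h => h4 h.1 h.2)]
  simp

/-- **EVERY PLAQUETTE THROUGH THE EXTERIOR DIAGONAL BOND IS PINNED BY `Γ₀`**: for `x = π(−e_{μ₀} − e_{ν₁})` and a plaquette `p` carrying `⟨x, μ₀⟩` in one of its slots, the source
of `p` and its two near corners lie OUTSIDE the cube `π([0, L−1]ᵈ) = B(0)` (each has a coordinate `−1` or `−2`; period `≥ L + 2`). [cite: Balaban1988Convergent, (2.2) p.255 (bookkeeping)] -/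
theorem pinned_of_slots (hS : (P.L : ℤ) + 2 ≤ P.sitesPerDir 0) {μ0 ν₁ : Fin P.d} (hne : ν₁ ≠ μ0) (p : Plaq P 0)
    (hp : (p.src = cover P (fun i => if i = μ0 ∨ i = ν₁ then (-1 : ℤ) else 0) ∧ p.μ = μ0) ∨
      (p.src.shift p.μ = cover P (fun i => if i = μ0 ∨ i = ν₁ then (-1 : ℤ) else 0) ∧ p.ν = μ0) ∨
      (p.src.shift p.ν = cover P (fun i => if i = μ0 ∨ i = ν₁ then (-1 : ℤ) else 0) ∧ p.μ = μ0) ∨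
      (p.src = cover P (fun i => if i = μ0 ∨ i = ν₁ then (-1 : ℤ) else 0) ∧ p.ν = μ0)) :
    p.src ∉ cubeEnl P P.L 0 0 ∧ p.src.shift p.μ ∉ cubeEnl P P.L 0 0 ∧ p.src.shift p.ν ∉ cubeEnl P P.L 0 0 := by
  set w₀ : Pt P.d := fun i => if i = μ0 ∨ i = ν₁ then (-1 : ℤ) else 0 with hw₀
  have hw₀μ : w₀ μ0 = -1 := by simp [hw₀]
  have hw₀ν : w₀ ν₁ = -1 := by simp [hw₀]
  set x : Site P 0 := cover P w₀ with hx
  have hμν : p.μ ≠ p.ν := p.hμν.ne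
  -- the five kinds of sites that occur
  have Hx : x ∉ cubeEnl P P.L 0 0 := cover_notMem_cubeEnl_zero_of_neg w₀ (i := μ0) (by rw [hw₀μ]; norm_num) (by rw [hw₀μ]; omega)
  have Hxμ : x.shift μ0 ∉ cubeEnl P P.L 0 0 := by
    rw [hx, shift_cover]
    refine cover_notMem_cubeEnl_zero_of_neg _ (i := ν₁) ?_ ?_ <;> rw [Function.update_of_ne hne, hw₀ν] <;> omega
  have Hxd : ∀ d, d ≠ μ0 → x.shift d ∉ cubeEnl P P.L 0 0 := by
    intro d hd
    rw [hx, shift_cover]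
    refine cover_notMem_cubeEnl_zero_of_neg _ (i := μ0) ?_ ?_ <;> rw [Function.update_of_ne (Ne.symm hd), hw₀μ] <;> omega
  have Hxu : ∀ d, d ≠ μ0 → x.unshift d ∉ cubeEnl P P.L 0 0 := by
    intro d hd
    rw [hx, unshift_cover]
    refine cover_notMem_cubeEnl_zero_of_neg _ (i := μ0) ?_ ?_ <;> rw [Function.update_of_ne (Ne.symm hd), hw₀μ] <;> omega
  have Hxuμ : ∀ d, d ≠ μ0 → (x.unshift d).shift μ0 ∉ cubeEnl P P.L 0 0 := by
    intro d hd
    rw [hx, unshift_cover, shift_cover]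
    have hv : Function.update (Function.update w₀ d (w₀ d - 1)) μ0 (Function.update w₀ d (w₀ d - 1) μ0 + 1) ν₁ = -1 ∨
        Function.update (Function.update w₀ d (w₀ d - 1)) μ0 (Function.update w₀ d (w₀ d - 1) μ0 + 1) ν₁ = -2 := by
      rw [Function.update_of_ne hne]
      by_cases hdν : ν₁ = d
      · subst hdν; rw [Function.update_self, hw₀ν]; right; norm_num
      · rw [Function.update_of_ne hdν, hw₀ν]; left; rfl
    rcases hv with hv | hv
    · exact cover_notMem_cubeEnl_zero_of_neg _ (i := ν₁) (by rw [hv]; norm_num) (by rw [hv]; omega)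
    · exact cover_notMem_cubeEnl_zero_of_neg _ (i := ν₁) (by rw [hv]; norm_num) (by rw [hv]; omega)
  rcases hp with ⟨h1, h2⟩ | ⟨h1, h2⟩ | ⟨h1, h2⟩ | ⟨h1, h2⟩
  · -- `p = ⟨x; μ₀, ν⟩`
    have hν : p.ν ≠ μ0 := fun h => hμν (h2.trans h.symm)
    rw [h1, h2]; exact ⟨Hx, Hxμ, Hxd _ hν⟩
  · -- `p = ⟨x − e_μ; μ, μ₀⟩`
    have hμ : p.μ ≠ μ0 := fun h => hμν (h.trans h2.symm)
    have hs : p.src = x.unshift p.μ := by rw [← h1, Site.unshift_shift]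
    rw [hs, Site.shift_unshift, h2]; exact ⟨Hxu _ hμ, Hx, Hxuμ _ hμ⟩
  · -- `p = ⟨x − e_ν; μ₀, ν⟩`
    have hν : p.ν ≠ μ0 := fun h => hμν (h2.trans h.symm)
    have hs : p.src = x.unshift p.ν := by rw [← h1, Site.unshift_shift]
    rw [hs, Site.shift_unshift, h2]; exact ⟨Hxu _ hν, Hxuμ _ hν, Hx⟩
  · -- `p = ⟨x; μ, μ₀⟩`
    have hμ : p.μ ≠ μ0 := fun h => hμν (h.trans h2.symm)
    rw [h1, h2]; exact ⟨Hx, Hxd _ hμ, Hxμ⟩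

end ExteriorTwist

/-! ## §3  ★ The exterior diagonal twist is critical on the record's fibre of `𝐁 = genSet Ω 1`, `Ω₁ = B(0)` — by Fermat, for EVERY `g₀` -/
section Critical

open T4Continuum (T4Family)

variable (F : T4Family) (N : ℕ) [NeZero N]

/-- **★ A (b)-CRITICAL CONFIGURATION WITH NO VARIATIONAL PROBLEM BEHIND IT.**  On the torus `F.P K` with the one-cube index's region `Ω₁ = π([0, L−1]⁴) = B(0)` (dag-n21-c
`exists_seq_singleCube`), the configuration `U = (g₀ on the exterior diagonal bond ⟨π(−e_{μ₀} − e_{ν₁}), μ₀⟩, 1 elsewhere)` is a CRITICAL CONFIGURATION OF (5) ON THE RECORD's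
FIBRE (`Node00.IsCritOnFibre F N K (genSet Ω 1) (M_𝐁 U) U`, reading (b): all bonds MEETING `Γ₀ = Ω₁ᶜ` pinned at level 0) — for EVERY `g₀ ∈ SU(N)`: along a fibre curve `γ′` the
plaquettes through the twisted bond are pinned (§2 + `plaqHol_eq_of_agreeOn`) and every other plaquette is flat at `U`, so `A(γ′ t) ≥ A(U)` near `0` and the derivative vanishes
(Fermat).  Nothing small, no class, no minimiser. [cite: Balaban1985Variational, (5)–(6) p.278, Prop. 8 p.304; Balaban1988Convergent, (2.2) p.255, (2.10)–(2.12) p.256] -/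
theorem isCritOnFibre_extTwist (K : ℕ) (hS : ((F.P K).L : ℤ) + 2 ≤ (F.P K).sitesPerDir 0)
    (Ω : ℕ → Set (Site (F.P K) 0)) (hΩ : Ω 1 = cubeEnl (F.P K) (F.P K).L 0 0) {μ0 ν₁ : Fin (F.P K).d} (hne : ν₁ ≠ μ0)
    (g₀ : Matrix.specialUnitaryGroup (Fin N) ℂ) :
    IsCritOnFibre F N K (genSet Ω 1)
      (avgFamily (avOfRecord F N K) (fun b : PBond (F.P K) 0 => if b.src = cover (F.P K) (fun i => if i = μ0 ∨ i = ν₁ then (-1 : ℤ) else 0) ∧ b.dir = μ0 then g₀ else 1))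
      (fun b : PBond (F.P K) 0 => if b.src = cover (F.P K) (fun i => if i = μ0 ∨ i = ν₁ then (-1 : ℤ) else 0) ∧ b.dir = μ0 then g₀ else 1) := by
  set U : GaugeField (F.P K) 0 (Matrix.specialUnitaryGroup (Fin N) ℂ) :=
    fun b => if b.src = cover (F.P K) (fun i => if i = μ0 ∨ i = ν₁ then (-1 : ℤ) else 0) ∧ b.dir = μ0 then g₀ else 1 with hU
  intro γ h0 hd hc a ha
  refine IsLocalMin.hasDerivAt_eq_zero ?_ ha
  filter_upwards [hc] with t ht
  show wilsonAction4 (γ 0) ≤ wilsonAction4 (γ t)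
  rw [h0]
  unfold wilsonAction4 wilsonAction
  refine Finset.sum_le_sum fun p _ => ?_
  rw [one_mul, one_mul]
  by_cases hp : GaugeField.plaqHol U p = 1
  · rw [hp, GaugeGroup.reTr_one]
    linarith [GaugeGroup.reTr_le_one (GaugeField.plaqHol (γ t) p)]
  · obtain ⟨h1, h2, h3⟩ := pinned_of_slots hS hne p (slots_of_plaqHol_single_ne_one _ μ0 g₀ p hp)
    rw [← hΩ] at h1 h2 h3
    rw [plaqHol_eq_of_agreeOn (avOfRecord F N K) one_pos ht p h1 h2 h3]
    rfl

end Critical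

/-! ## §4  The plaquette dichotomy along the two-connector twist `V = (g on ⟨x + e_{ν₁}, μ₀⟩)·(g⁻¹ on ⟨x + 2e_{ν₁}, μ₀⟩)·U` -/
section Dichotomy

variable {G : Type*} [GaugeGroup G]

/-- A plaquette variable depends only on the four slot bonds. [cite: Balaban1985Averaging, (9) p.19 (bookkeeping)] -/
theorem plaqHol_congr_slots (V U : GaugeField P 0 G) (p : Plaq P 0) (h1 : V ⟨p.src, p.μ⟩ = U ⟨p.src, p.μ⟩)
    (h2 : V ⟨p.src.shift p.μ, p.ν⟩ = U ⟨p.src.shift p.μ, p.ν⟩) (h3 : V ⟨p.src.shift p.ν, p.μ⟩ = U ⟨p.src.shift p.ν, p.μ⟩) (h4 : V ⟨p.src, p.ν⟩ = U ⟨p.src, p.ν⟩) :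
    GaugeField.plaqHol V p = GaugeField.plaqHol U p := by
  simp only [GaugeField.plaqHol, h1, h2, h3, h4]

/-- **THE CORNER PLAQUETTE `p₀ = ⟨x; μ₀, ν₁⟩` ALONG THE TWIST**: its variable is `g₀ · g⁻¹` (the exterior bond `⟨x, μ₀⟩` reads `g₀`, the inward connector `⟨x + e_{ν₁}, μ₀⟩` reads
`g`, the two `ν₁`-bonds read `1`; period `> 3`). [cite: Balaban1985Averaging, (9) p.19 (bookkeeping)] -/
theorem plaqHol_twist_corner (hS3 : 3 < P.sitesPerDir 0) {μ0 ν₁ : Fin P.d} (hne : ν₁ ≠ μ0) (hμν : μ0 < ν₁) (g g₀ : G) :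
    GaugeField.plaqHol
      (fun b : PBond P 0 =>
        (if b.src = (cover P (fun i => if i = μ0 ∨ i = ν₁ then (-1 : ℤ) else 0)).shift ν₁ ∧ b.dir = μ0 then g else 1) *
        (if b.src = ((cover P (fun i => if i = μ0 ∨ i = ν₁ then (-1 : ℤ) else 0)).shift ν₁).shift ν₁ ∧ b.dir = μ0 then g⁻¹ else 1) *
        (if b.src = cover P (fun i => if i = μ0 ∨ i = ν₁ then (-1 : ℤ) else 0) ∧ b.dir = μ0 then g₀ else 1))
      ⟨cover P (fun i => if i = μ0 ∨ i = ν₁ then (-1 : ℤ) else 0), μ0, ν₁, hμν⟩ = g₀ * g⁻¹ := by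
  set x : Site P 0 := cover P (fun i => if i = μ0 ∨ i = ν₁ then (-1 : ℤ) else 0) with hx
  have hxx₁ : x ≠ x.shift ν₁ :=
    site_ne_of_coord ν₁ 1 (by rw [Site.shift_apply, if_pos rfl]; push_cast; ring) one_ne_zero (by simp; omega)
  have hxx₁' : x ≠ (x.shift ν₁).shift ν₁ :=
    site_ne_of_coord ν₁ 2 (by rw [Site.shift_apply, if_pos rfl, Site.shift_apply, if_pos rfl]; push_cast; ring) two_ne_zero (by simp; omega)
  have hx₁x₁' : x.shift ν₁ ≠ (x.shift ν₁).shift ν₁ :=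
    site_ne_of_coord ν₁ 1 (by rw [Site.shift_apply (x.shift ν₁), if_pos rfl]; push_cast; ring) one_ne_zero (by simp; omega)
  simp [GaugeField.plaqHol, hxx₁, hxx₁', hx₁x₁', hxx₁.symm, hne]

/-- **THE DICHOTOMY**: at every plaquette OTHER than the corner plaquette `p₀`, the twisted configuration `V` has the same plaquette variable as `U`, or `U`'s is `1` (a plaquette
through the exterior bond other than `p₀` avoids both connectors; `μ₀ < ν₁`, period `> 3`). [cite: Balaban1985Averaging, (9) p.19 (bookkeeping)] -/
theorem plaqHol_twist_dichotomy (hS3 : 3 < P.sitesPerDir 0) {μ0 ν₁ : Fin P.d} (hne : ν₁ ≠ μ0) (hμν : μ0 < ν₁) (g g₀ : G) (p : Plaq P 0)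
    (hp : p ≠ ⟨cover P (fun i => if i = μ0 ∨ i = ν₁ then (-1 : ℤ) else 0), μ0, ν₁, hμν⟩) :
    GaugeField.plaqHol
      (fun b : PBond P 0 =>
        (if b.src = (cover P (fun i => if i = μ0 ∨ i = ν₁ then (-1 : ℤ) else 0)).shift ν₁ ∧ b.dir = μ0 then g else 1) *
        (if b.src = ((cover P (fun i => if i = μ0 ∨ i = ν₁ then (-1 : ℤ) else 0)).shift ν₁).shift ν₁ ∧ b.dir = μ0 then g⁻¹ else 1) *
        (if b.src = cover P (fun i => if i = μ0 ∨ i = ν₁ then (-1 : ℤ) else 0) ∧ b.dir = μ0 then g₀ else 1)) p =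
      GaugeField.plaqHol (fun b : PBond P 0 => if b.src = cover P (fun i => if i = μ0 ∨ i = ν₁ then (-1 : ℤ) else 0) ∧ b.dir = μ0 then g₀ else 1) p ∨
    GaugeField.plaqHol (fun b : PBond P 0 => if b.src = cover P (fun i => if i = μ0 ∨ i = ν₁ then (-1 : ℤ) else 0) ∧ b.dir = μ0 then g₀ else 1) p = 1 := by
  set x : Site P 0 := cover P (fun i => if i = μ0 ∨ i = ν₁ then (-1 : ℤ) else 0) with hx
  set U : GaugeField P 0 G := fun b => if b.src = x ∧ b.dir = μ0 then g₀ else 1 with hU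
  set VA : GaugeField P 0 G := fun b => if b.src = x.shift ν₁ ∧ b.dir = μ0 then g else 1 with hVA
  set VB : GaugeField P 0 G := fun b => if b.src = (x.shift ν₁).shift ν₁ ∧ b.dir = μ0 then g⁻¹ else 1 with hVB
  by_cases hU1 : GaugeField.plaqHol U p = 1
  · exact Or.inr hU1
  left
  -- coordinates `ν₁` of the sites at hand
  have hx₁ν : (x.shift ν₁) ν₁ = x ν₁ + 1 := by rw [Site.shift_apply, if_pos rfl]
  have hx₁'ν : ((x.shift ν₁).shift ν₁) ν₁ = x ν₁ + 2 := by rw [Site.shift_apply, if_pos rfl, hx₁ν]; ring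
  -- the site inequalities
  have n1 : x ≠ x.shift ν₁ := site_ne_of_coord ν₁ 1 (by rw [hx₁ν]; push_cast; ring) one_ne_zero (by simp; omega)
  have n2 : x ≠ (x.shift ν₁).shift ν₁ := site_ne_of_coord ν₁ 2 (by rw [hx₁'ν]; push_cast; ring) two_ne_zero (by simp; omega)
  have n3 : ∀ d, d ≠ ν₁ → x.shift d ≠ x.shift ν₁ := fun d hd =>
    site_ne_of_coord ν₁ 1 (by rw [hx₁ν, Site.shift_apply, if_neg (Ne.symm hd)]; push_cast; ring) one_ne_zero (by simp; omega)
  have n4 : ∀ d, x.shift d ≠ (x.shift ν₁).shift ν₁ := by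
    intro d
    by_cases hd : ν₁ = d
    · subst hd
      exact site_ne_of_coord ν₁ 1 (by rw [hx₁'ν, hx₁ν]; push_cast; ring) one_ne_zero (by simp; omega)
    · exact site_ne_of_coord ν₁ 2 (by rw [hx₁'ν, Site.shift_apply, if_neg hd]; push_cast; ring) two_ne_zero (by simp; omega)
  have n5 : ∀ d, x.unshift d ≠ x.shift ν₁ := by
    intro d
    by_cases hd : ν₁ = d
    · subst hd
      exact site_ne_of_coord ν₁ 2 (by rw [hx₁ν, Site.unshift_apply, if_pos rfl]; push_cast; ring) two_ne_zero (by simp; omega)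
    · exact site_ne_of_coord ν₁ 1 (by rw [hx₁ν, Site.unshift_apply, if_neg hd]; push_cast; ring) one_ne_zero (by simp; omega)
  have n6 : ∀ d, x.unshift d ≠ (x.shift ν₁).shift ν₁ := by
    intro d
    by_cases hd : ν₁ = d
    · subst hd
      exact site_ne_of_coord ν₁ 3 (by rw [hx₁'ν, Site.unshift_apply, if_pos rfl]; push_cast; ring) three_ne_zero (by simp; omega)
    · exact site_ne_of_coord ν₁ 2 (by rw [hx₁'ν, Site.unshift_apply, if_neg hd]; push_cast; ring) two_ne_zero (by simp; omega)
  -- `V b = U b` at a bond whose source is neither connector source (or whose direction is not `μ₀`)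
  have hVU : ∀ b : PBond P 0, ¬ (b.src = x.shift ν₁ ∧ b.dir = μ0) → ¬ (b.src = (x.shift ν₁).shift ν₁ ∧ b.dir = μ0) →
      VA b * VB b * U b = U b := by
    intro b hb1 hb2
    simp only [hVA, hVB]
    rw [if_neg hb1, if_neg hb2, one_mul, one_mul]
  show GaugeField.plaqHol (fun b => VA b * VB b * U b) p = GaugeField.plaqHol U p
  have hμν' : p.μ ≠ p.ν := p.hμν.ne
  rcases slots_of_plaqHol_single_ne_one x μ0 g₀ p hU1 with ⟨h1, h2⟩ | ⟨h1, h2⟩ | ⟨h1, h2⟩ | ⟨h1, h2⟩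
  · -- `p = ⟨x; μ₀, ν⟩` with `ν ≠ ν₁` (else `p = p₀`)
    have hν : p.ν ≠ ν₁ := by
      intro h
      apply hp
      obtain ⟨ps, pμ, pν, ph⟩ := p
      simp only at h1 h2 h ⊢
      subst h1; subst h2; subst h
      rfl
    refine plaqHol_congr_slots _ _ p (hVU _ ?_ ?_) (hVU _ ?_ ?_) (hVU _ ?_ ?_) (hVU _ ?_ ?_)
    · rintro ⟨h, -⟩; exact n1 (h1 ▸ h)
    · rintro ⟨h, -⟩; exact n2 (h1 ▸ h)
    · rintro ⟨-, h⟩; exact hμν' (h2.trans h.symm)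
    · rintro ⟨-, h⟩; exact hμν' (h2.trans h.symm)
    · rintro ⟨h, -⟩; rw [h1] at h; exact n3 _ hν h
    · rintro ⟨h, -⟩; rw [h1] at h; exact n4 _ h
    · rintro ⟨-, h⟩; exact hμν' (h2.trans h.symm)
    · rintro ⟨-, h⟩; exact hμν' (h2.trans h.symm)
  · -- `p = ⟨x − e_μ; μ, μ₀⟩`
    have hs : p.src = x.unshift p.μ := by rw [← h1, Site.unshift_shift]
    have hμ : p.μ ≠ μ0 := fun h => hμν' (h.trans h2.symm)
    refine plaqHol_congr_slots _ _ p (hVU _ ?_ ?_) (hVU _ ?_ ?_) (hVU _ ?_ ?_) (hVU _ ?_ ?_)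
    · rintro ⟨-, h⟩; exact hμ h
    · rintro ⟨-, h⟩; exact hμ h
    · rintro ⟨h, -⟩; simp only at h; rw [h1] at h; exact n1 h
    · rintro ⟨h, -⟩; simp only at h; rw [h1] at h; exact n2 h
    · rintro ⟨-, h⟩; exact hμ h
    · rintro ⟨-, h⟩; exact hμ h
    · rintro ⟨h, -⟩; simp only at h; rw [hs] at h; exact n5 _ h
    · rintro ⟨h, -⟩; simp only at h; rw [hs] at h; exact n6 _ h
  · -- `p = ⟨x − e_ν; μ₀, ν⟩`
    have hs : p.src = x.unshift p.ν := by rw [← h1, Site.unshift_shift]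
    have hν : p.ν ≠ μ0 := fun h => hμν' (h2.trans h.symm)
    refine plaqHol_congr_slots _ _ p (hVU _ ?_ ?_) (hVU _ ?_ ?_) (hVU _ ?_ ?_) (hVU _ ?_ ?_)
    · rintro ⟨h, -⟩; simp only at h; rw [hs] at h; exact n5 _ h
    · rintro ⟨h, -⟩; simp only at h; rw [hs] at h; exact n6 _ h
    · rintro ⟨-, h⟩; exact hν h
    · rintro ⟨-, h⟩; exact hν h
    · rintro ⟨h, -⟩; simp only at h; rw [h1] at h; exact n1 h
    · rintro ⟨h, -⟩; simp only at h; rw [h1] at h; exact n2 h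
    · rintro ⟨-, h⟩; exact hν h
    · rintro ⟨-, h⟩; exact hν h
  · -- `p = ⟨x; μ, μ₀⟩` with `μ < μ₀ < ν₁`
    have hμ : p.μ ≠ μ0 := fun h => hμν' (h.trans h2.symm)
    have hμ1 : p.μ ≠ ν₁ := by
      intro h; have := p.hμν; rw [h, h2] at this; exact lt_asymm hμν this
    refine plaqHol_congr_slots _ _ p (hVU _ ?_ ?_) (hVU _ ?_ ?_) (hVU _ ?_ ?_) (hVU _ ?_ ?_)
    · rintro ⟨-, h⟩; exact hμ h
    · rintro ⟨-, h⟩; exact hμ h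
    · rintro ⟨h, -⟩; simp only at h; rw [h1] at h; exact n3 _ hμ1 h
    · rintro ⟨h, -⟩; simp only at h; rw [h1] at h; exact n4 _ h
    · rintro ⟨-, h⟩; exact hμ h
    · rintro ⟨-, h⟩; exact hμ h
    · rintro ⟨h, -⟩; simp only at h; rw [h1] at h; exact n1 h
    · rintro ⟨h, -⟩; simp only at h; rw [h1] at h; exact n2 h

end Dichotomy

end Summit.QuantumFields.YangMills.BalabanUVNodes.N07SeamWitness

end
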